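import Summits.AnomalousDissipation.AnomalousDissipation.Theses.ErgodicMirrorGate

/-!
# Glue of the twin (climate) SkeletonTubeCut split of `ErgodicMirrorGate.NoMirrorEulerClimateTG`

Sorry-free proof of the GLUE item `ErgodicMirrorGate.NoMirrorEulerClimateTGGlue` (stmt-AnomalousDissipation-27272):
`NoThinMirrorClimateTG → NoFatMirrorClimateTG → NoMirrorEulerClimateTG` — excluded middle on (measurable-and-)thin-at-the-
skeleton for a K-symmetric stationary Euler climate absorbing the Taylor–Green input, plus the two kernel necessities and the
exactness N_stat ⟺ A_stat ∧ B_stat.  Pure logic over the shared hypothesis block; no facts asserted.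
Source: decomp-ad cell, lens-6 g18 node «SkeletonTubeCut» twin cut for ErgodicMirrorGate (kernel
`run/shared/lean/pub/decomp-ad/decomp-ad-lens-6/g18/SkeletonTubeCut.lean`); landed by the cell's prover seat.  Nothing here proves the summit.
-/

set_option linter.dupNamespace false

namespace Summit.AnomalousDissipation.AnomalousDissipation.Theorems.SkeletonTubeCutClimateGlue

open Summit.AnomalousDissipation.AnomalousDissipation.Theses
open Summit.AnomalousDissipation.AnomalousDissipation.Theses.ErgodicMirrorGate

/-- A_stat ∧ B_stat ⇒ N_stat: excluded middle on (measurable-and-)thin at the skeleton. [folklore] -/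
theorem noMirrorEulerClimateTG_of_thin_fat (hA : NoThinMirrorClimateTG) (hB : NoFatMirrorClimateTG) :
    NoMirrorEulerClimateTG := by
  intro f hf E M Ω _ P S traj hP hS hshift hsol hK hm₁ hm₂ hE hM
  exact Classical.byCases (hA f hf E M Ω P S traj hP hS hshift hsol hK hm₁ hm₂ hE hM)
    (hB f hf E M Ω P S traj hP hS hshift hsol hK hm₁ hm₂ hE hM)

/-- Kernel necessity N_stat ⇒ A_stat. [folklore] -/
theorem noThinMirrorClimateTG_of_noMirrorEulerClimateTG (hN : NoMirrorEulerClimateTG) : NoThinMirrorClimateTG :=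
  fun f hf E M Ω _ P S traj hP hS hshift hsol hK hm₁ hm₂ hE hM _ =>
    hN f hf E M Ω P S traj hP hS hshift hsol hK hm₁ hm₂ hE hM

/-- Kernel necessity N_stat ⇒ B_stat. [folklore] -/
theorem noFatMirrorClimateTG_of_noMirrorEulerClimateTG (hN : NoMirrorEulerClimateTG) : NoFatMirrorClimateTG :=
  fun f hf E M Ω _ P S traj hP hS hshift hsol hK hm₁ hm₂ hE hM _ =>
    hN f hf E M Ω P S traj hP hS hshift hsol hK hm₁ hm₂ hE hM

/-- EXACTNESS of the twin cut: `NoMirrorEulerClimateTG ↔ NoThinMirrorClimateTG ∧ NoFatMirrorClimateTG`. [folklore] -/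
theorem noMirrorEulerClimateTG_iff_thin_and_fat :
    NoMirrorEulerClimateTG ↔ (NoThinMirrorClimateTG ∧ NoFatMirrorClimateTG) :=
  ⟨fun h => ⟨noThinMirrorClimateTG_of_noMirrorEulerClimateTG h, noFatMirrorClimateTG_of_noMirrorEulerClimateTG h⟩,
   fun h => noMirrorEulerClimateTG_of_thin_fat h.1 h.2⟩

/-- GLUE item 27272 `NoMirrorEulerClimateTGGlue` by name (through the exactness of the cut). [folklore] -/
theorem noMirrorEulerClimateTGGlue_holds : NoMirrorEulerClimateTGGlue :=
  fun hA hB => noMirrorEulerClimateTG_iff_thin_and_fat.mpr ⟨hA, hB⟩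

end Summit.AnomalousDissipation.AnomalousDissipation.Theorems.SkeletonTubeCutClimateGlue
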